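/-
Copyright (c) 2026 the pub-hodgecm-mathlib formalisation cell (harness21).  Prover seat hodgecm-mathlib-LH4-p05 (g3), req620 Track A «(D-RAM) FOUR-FRAME» squad
(unit U3_Laws, (R-18) «K-ABS-R := NI2 ⊕ KMS»; THE (KMS) REDUCTION HEAD «MODULO κ-STAGE B»: the registered stub `stub_U3_kappaModelSum`'s sentence, token for token, from this
seat's κ-Stage A at type 0 and three named inputs — the type-2 κ-Stage-A head WITH MULTIPLICITY ((R-21) re-key) and the two κ-Stage-B sums; dealer LH4-plan (g11) WORD #20∕#21,
LH4-p11 (g2) RULING (R-21), LH-ref2 (g10) BOX #8; plan `F0/P3c/LH4/LH4-p05/g3/PLAN-KMS-modKappaStageB.v1`).  2026-09-04.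
-/
import Summits.HodgeConjecture.HodgeConjecture.Theorems.F0P3cDyRamDiagonalKappaOrbitCount      -- (Oκ2c)₀ (this seat): `cast_sum_signChar_mul_ncard_eq_eight_mul_finsum_kappaCount_zero`; brings the DEFS leaf (`kappaCount`), ★ StrataDefs ED. 3, ★ TorusDefs
import Summits.HodgeConjecture.HodgeConjecture.Theorems.F0P3cDyRamStableModelSumOfStageB        -- ★ p856175 (LH4-p11): §1 `not_exists_mul_map_eq_of_dichotomy`, §2 `v_vecCons_eq_one_of_isElementDatum`, `vecCons_injective_of_isElementDatum`; brings ★ LawDefs (`DyadicFence`)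
import Summits.HodgeConjecture.HodgeConjecture.Theorems.F0P3cDyRamFourFrameLawDefsR             -- ★ DEFS LEAF №1-R p855074: `shiftR`
import HarnessLib

/-!
# Crux `H413`, line LH4 «(D-RAM) FOUR-FRAME» road — unit U3_Laws (iii): THE EIGHTFOLD κ-MODEL SUM (KMS) MODULO κ-STAGE B —
# `stub_U3_kappaModelSum`'s sentence from this seat's κ-Stage A₀, the non-norm unit, and three named inputs (κ-Stage A₂ with multiplicity, κ-Stage B₀, κ-Stage B₂)

Cell `hodgecm-mathlib` (D-0151), FLOOR 0, crux item H413 = `stmt-HodgeConjecture-24833`, route of record `HCCMUnconditional`; squad F0∕P3c∕LH4 (req618∕req620); registered stub served: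
`F0P3cDyRamFourFrameU3.stub_U3_kappaModelSum` (KMS; tree `Cruxes/H413/Lines/F0_P3c_DyRamFourFrame_U3_Laws.lean` ED. 7 :407–:429), through which `stub_U3_kappaAbsLawR` (the re-cut
κ-AMPLITUDE law of record) is PAID by composition (★ p855529).  THEOREMS ONLY (no `def`, no instance, no notation, no `sorry`, default heartbeats); lane `--supports
stmt-HodgeConjecture-24833` (count-neutral).  CONDITIONAL ON PROVER TARGETS, NOT ON LITERATURE: the three hypotheses are κ-Stage-A₂ ∕ κ-Stage-B heads of the (KMS) road (an
empirical census law in diagonal-model currency), stated as ∀-closed Lean sentences over the DEFS leaf `…DiagonalKappaCountDefs`; nothing printed is asserted and no `def … : Prop`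
is introduced.  NO UNIQ₂-SHAPED BINDER ((R-21): ★ p856175's `huniq₂` is unsatisfiable on the glued type-2 strata with `ρ` even — LH4-p09 (g2); this head does not repeat it).

THE MATHEMATICS (PLAN v1; the (MS) template ★ p856175).  The (KMS) sentence: behind the dyadic fence, at a ramified quadratic datum `(σ, ϖ, d, t)` over a complete `K` with finite
residue field, for a `σ`-fixed unit `c` with the index-two dichotomy, an element datum `(α, β; n₁, n₂, n₃)` at `depthOfRecord d`, `T = diag(α, β, 1)`, `2k + d = Σn + 2`, a slot `i` and
the re-cut parity datum `2B = n_i − d + 2 − 2·shiftR d t`:  `|Σ_e χ⁰_i(e)·C₀(e)| = 2·ampl q k B` and `|Σ_e χ⁰_i(e)·C₂(e)| = 2·ampl q k (B + τ d)`, `C_tv(e) = #{M : M type-tv for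
diag(d_e), T·M = M}`.  PROOF (sorry-free over the three inputs): (1) `c` is a NON-NORM and (2) `(α, β, 1)` is a regular unit diagonal (★ p11 §1–§2); (3) TYPE 0: this seat's ★
(Oκ2c)₀ `cast_sum_signChar_mul_ncard_eq_eight_mul_finsum_kappaCount_zero` — UNCONDITIONAL κ-Stage A at `tv = 0` — turns `Σ_e χ⁰_i(e)·C₀(e)` into `8·X₀`,
`X₀ = Σᶠ_{M ∈ 𝓛₀(T), dualisable} kappaCount σ ϖ 0 i M · stabiliserWeight σ M`, and `hBκ10` says `|X₀| = ampl q k B ∕ 4`; (4) TYPE 2: the κ-Stage-A₂ head WITH MULTIPLICITY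
`hAκ2` (to be ★ on top of LH4-p14's (O2b)-MULT; binder for binder this seat's (Oκ2c) head without `hcoset`, `kappaCount σ ϖ 2` = the SIGNED class count) turns `Σ_e χ⁰_i(e)·C₂(e)`
into `8·X₂`, and `hBκ10₂` says `|X₂| = ampl q k (B + τ d) ∕ 4`; (5) `|8X| = 8|X| = 2·ampl`.  So the KMS payer `Theorems/F0P3cDyRamKappaModelSum.lean :: kappaModelSum` is ONE
APPLICATION of this theorem to the three ★ heads the hour they land, and the U3 edition pays `stub_U3_kappaModelSum := F0P3cDyRamKappaModelSum.kappaModelSum` (bare constant; the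
by-name TYPE tie `∃ A B C, type_of% this = (A → B → C → type_of% stub)` is `rfl`, HOME probe `KMSHead.SKELETON.v2`).  DATUM GUARD KEPT LITERAL in `hBκ10`∕`hBκ10₂`
(`IsElementDatum σ ϖ (depthOfRecord d) …`, no `d ≤ N₀` generalisation; REF5 R5-39∕R5-40).

WHAT IS PROVED.
* `kappaModelSum_of_kappaStageB (hAκ2) (hBκ10) (hBκ10₂) : ‹the KMS sentence, U3 :407–:429 token for token›`.
HONEST LABEL.  Count-neutral (`--supports`); CONDITIONAL on three PROVER TARGETS (κ-Stage A₂-MULT, κ-Stage B₀, κ-Stage B₂ of the KMS road), none a literature fact; (KMS) stays a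
PROVER TARGET until they land; `HC_CM` is proved only modulo the 7 printed citations (2 remaining named inputs: hLiu418 = `stmt-HodgeConjecture-24832`, h413 =
`stmt-HodgeConjecture-24833`) until rung 0 closes.

## References
* [Kottwitz1986BaseChangeUnits] R. E. Kottwitz, *Base change for unit elements of Hecke algebras*, Compositio Math. 60 (1986), §1 pp. 240–241 (κ-orbital integrals of units as
  signed lattice counts modulo the torus).
* [Rogawski1990] J. D. Rogawski, *Automorphic Representations of Unitary Groups in Three Variables*, Ann. of Math. Stud. 123 (1990), §4.9 Prop. 4.9.1 (a) p. 55, §4.10 p. 58.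
* [LanglandsShelstad1987] R. P. Langlands, D. Shelstad, *On the definition of transfer factors*, Math. Ann. 278 (1987), §3.
* [Serre1979] J.-P. Serre, *Local Fields*, GTM 67 (1979), Ch. V §3 Cor. 3 (the unit norm index of a totally ramified cyclic extension of prime degree).
-/

set_option autoImplicit false

noncomputable section

namespace Summit.HodgeConjecture.HodgeConjecture.Cruxes.H413.F0P3cDyRamKappaModelSumOfKappaStageB

open scoped Valued WithZero Matrix MatrixGroups
open Literature.NumberTheory.Automorphic Literature.NumberTheory.Automorphic.HermitianLattice
  Literature.NumberTheory.Automorphic.UnitaryLatticeTree Literature.NumberTheory.Automorphic.UnitaryThreeFourFrame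
open Summit.HodgeConjecture.HodgeConjecture.Cruxes.H413.F0P3cDyRamFourFrameLawDefs
open Summit.HodgeConjecture.HodgeConjecture.Cruxes.H413.F0P3cDyRamFourFrameLawDefsR
open Summit.HodgeConjecture.HodgeConjecture.Cruxes.H413.F0P3cDyRamDiagonalTorusDefs
open Summit.HodgeConjecture.HodgeConjecture.Cruxes.H413.F0P3cDyRamDiagonalStrataDefs
open Summit.HodgeConjecture.HodgeConjecture.Cruxes.H413.F0P3cDyRamDiagonalKappaCountDefs
open Summit.HodgeConjecture.HodgeConjecture.Cruxes.H413.F0P3cDyRamDiagonalKappaOrbitCount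
open Summit.HodgeConjecture.HodgeConjecture.Cruxes.H413.F0P3cDyRamStableModelSumOfStageB

/-- **(KMS) MODULO κ-STAGE B — `stub_U3_kappaModelSum`'s SENTENCE TOKEN FOR TOKEN** (tree U3 ED. 7 :407–:429), from:
`hAκ2` — the κ-STAGE-A₂ HEAD WITH MULTIPLICITY: for a regular unit diagonal `T`, an isometric involution `σ`, a uniformiser, a `σ`-fixed non-norm unit `c` with the dichotomy and a slot
`i`, `↑(Σ_e χ⁰_i(e)·#{M : type-2 for diag(d_e), T·M = M}) = 8·Σᶠ_{M ∈ 𝓛₀(T), IsTypeTwoPolarisable} kappaCount σ ϖ 2 i M · stabiliserWeight σ M` (this seat's (Oκ2c) head at `tv = 2` WITHOUT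
the one-coset binder; (R-21) currency); `hBκ10` — the TYPE-0 κ-STAGE-B SUM `|Σᶠ_{M ∈ 𝓛₀(T), IsDualisableLattice} kappaCount σ ϖ 0 i M · stabiliserWeight σ M| = ampl q k B ∕ 4` at the
parameters of record; `hBκ10₂` — its TYPE-2 twin over `IsTypeTwoPolarisable` with `kappaCount σ ϖ 2` and `B + tauOfRecord d`.  Inside: ★ p11 §1 (non-norm `c`), §2 (regular unit
diagonal), this seat's ★ (Oκ2c)₀ `cast_sum_signChar_mul_ncard_eq_eight_mul_finsum_kappaCount_zero` (type 0, unconditional), `|8X| = 8|X|`.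
[cite: Kottwitz1986BaseChangeUnits, §1 pp. 240–241] [cite: Rogawski1990, §4.9 Prop. 4.9.1 (a) p. 55] [cite: LanglandsShelstad1987, §3] -/
theorem kappaModelSum_of_kappaStageB
    (hAκ2 : ∀ {K : Type} [Field K] [Valued K ℤᵐ⁰] [Finite 𝓀[K]] {σ : K →+* K}, (∀ x, σ (σ x) = x) → (∀ a, Valued.v (σ a) = Valued.v a) →
      ∀ {ϖ : K}, Valued.v ϖ = WithZero.exp (-1 : ℤ) → ∀ (ϖu : Kˣ), (ϖu : K) = ϖ →
      ∀ {c : K}, σ c = c → Valued.v c = 1 → (¬ ∃ z : K, z * σ z = c) →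
        (∀ x : K, σ x = x → x ≠ 0 → (∃ z : K, z * σ z = x) ∨ ∃ z : K, z * σ z = c * x) →
      ∀ {s : Fin 3 → K}, (∀ i, Valued.v (s i) = 1) → (∀ i j, i ≠ j → s i ≠ s j) →
      ∀ (T : GL (Fin 3) K), (T : Matrix (Fin 3) (Fin 3) K) = Matrix.diagonal s → ∀ (i : Fin 3),
        (((∑ e : Fin 3 → Bool,
            (![(if e 1 then -1 else 1) * (if e 2 then -1 else 1),
               (if e 0 then -1 else 1) * (if e 2 then -1 else 1),
               (if e 0 then -1 else 1) * (if e 1 then -1 else 1)] : Fin 3 → ℤ) i *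
              ({M : Submodule 𝒪[K] (Fin 3 → K) |
                IsVertexLattice σ ϖ (Matrix.diagonal fun j => if e j then c else (1 : K)) 2 M ∧ mapGL T M = M}.ncard : ℤ) : ℤ) : ℚ)) =
          8 * ∑ᶠ M₀ ∈ {M : Submodule 𝒪[K] (Fin 3 → K) | M ∈ normalisedStableLattices T ∧ IsTypeTwoPolarisable σ ϖ M},
            (kappaCount σ ϖ 2 i M₀ : ℚ) * stabiliserWeight σ M₀)
    (hBκ10 : ∀ {K : Type} [Field K] [Valued K ℤᵐ⁰] [Fintype 𝓀[K]] {σ : K →+* K} {ϖ : K} {d t : ℕ}, IsRamifiedQuadraticDatum σ ϖ d t →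
      Valued.v (2 : K) < 1 → ∀ {α β : K} {n₁ n₂ n₃ : ℕ}, IsElementDatum σ ϖ (depthOfRecord d) α β n₁ n₂ n₃ →
      ∀ (T : GL (Fin 3) K), (T : Matrix (Fin 3) (Fin 3) K) = Matrix.diagonal ![α, β, 1] → ∀ (k : ℕ), 2 * k + d = n₁ + n₂ + n₃ + 2 →
      ∀ (i : Fin 3) (B : ℤ), 2 * B = ((![n₁, n₂, n₃] : Fin 3 → ℕ) i : ℤ) - d + 2 - 2 * shiftR d t →
        |∑ᶠ M ∈ {M : Submodule 𝒪[K] (Fin 3 → K) | M ∈ normalisedStableLattices T ∧ IsDualisableLattice σ ϖ M},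
            (kappaCount σ ϖ 0 i M : ℚ) * stabiliserWeight σ M| = ampl (Fintype.card 𝓀[K]) k B / 4)
    (hBκ10₂ : ∀ {K : Type} [Field K] [Valued K ℤᵐ⁰] [Fintype 𝓀[K]] {σ : K →+* K} {ϖ : K} {d t : ℕ}, IsRamifiedQuadraticDatum σ ϖ d t →
      Valued.v (2 : K) < 1 → ∀ {α β : K} {n₁ n₂ n₃ : ℕ}, IsElementDatum σ ϖ (depthOfRecord d) α β n₁ n₂ n₃ →
      ∀ (T : GL (Fin 3) K), (T : Matrix (Fin 3) (Fin 3) K) = Matrix.diagonal ![α, β, 1] → ∀ (k : ℕ), 2 * k + d = n₁ + n₂ + n₃ + 2 →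
      ∀ (i : Fin 3) (B : ℤ), 2 * B = ((![n₁, n₂, n₃] : Fin 3 → ℕ) i : ℤ) - d + 2 - 2 * shiftR d t →
        |∑ᶠ M ∈ {M : Submodule 𝒪[K] (Fin 3 → K) | M ∈ normalisedStableLattices T ∧ IsTypeTwoPolarisable σ ϖ M},
            (kappaCount σ ϖ 2 i M : ℚ) * stabiliserWeight σ M| = ampl (Fintype.card 𝓀[K]) k (B + tauOfRecord d) / 4) :
    ∀ {K : Type} [Field K] [Valued K ℤᵐ⁰] [CompleteSpace K] [Fintype 𝓀[K]] (σ : K →+* K) (ϖ : K) (d t : ℕ),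
      DyadicFence (K := K) (IsRamifiedQuadraticDatum σ ϖ d t →
        ∀ c : K, σ c = c → Valued.v c = 1 → (∀ x : K, σ x = x → x ≠ 0 → (∃ z : K, z * σ z = x) ∨ ∃ z : K, z * σ z = c * x) →
        ∀ (α β : K) (n₁ n₂ n₃ : ℕ), IsElementDatum σ ϖ (depthOfRecord d) α β n₁ n₂ n₃ →
        ∀ (T : GL (Fin 3) K), (T : Matrix (Fin 3) (Fin 3) K) = Matrix.diagonal ![α, β, 1] →
        ∀ (k : ℕ), 2 * k + d = n₁ + n₂ + n₃ + 2 →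
        ∀ (i : Fin 3) (B : ℤ), 2 * B = ((![n₁, n₂, n₃] : Fin 3 → ℕ) i : ℤ) - d + 2 - 2 * shiftR d t →
          |((∑ s : Fin 3 → Bool,
              (![(if s 1 then -1 else 1) * (if s 2 then -1 else 1),
                 (if s 0 then -1 else 1) * (if s 2 then -1 else 1),
                 (if s 0 then -1 else 1) * (if s 1 then -1 else 1)] : Fin 3 → ℤ) i *
                ({M : Submodule 𝒪[K] (Fin 3 → K) |
                  IsVertexLattice σ ϖ (Matrix.diagonal fun j => if s j then c else (1 : K)) 0 M ∧ mapGL T M = M}.ncard : ℤ) : ℤ) : ℚ)| =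
            2 * ampl (Fintype.card 𝓀[K]) k B ∧
          |((∑ s : Fin 3 → Bool,
              (![(if s 1 then -1 else 1) * (if s 2 then -1 else 1),
                 (if s 0 then -1 else 1) * (if s 2 then -1 else 1),
                 (if s 0 then -1 else 1) * (if s 1 then -1 else 1)] : Fin 3 → ℤ) i *
                ({M : Submodule 𝒪[K] (Fin 3 → K) |
                  IsVertexLattice σ ϖ (Matrix.diagonal fun j => if s j then c else (1 : K)) 2 M ∧ mapGL T M = M}.ncard : ℤ) : ℤ) : ℚ)| =
            2 * ampl (Fintype.card 𝓀[K]) k (B + tauOfRecord d)) := by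
  intro K _ _ _ _ σ ϖ d t h2 hD c hσc hcv hdich α β n₁ n₂ n₃ hE T hT k hk i B hB
  have hσ : ∀ x, σ (σ x) = x := hD.1
  have hvσ : ∀ a, Valued.v (σ a) = Valued.v a := hD.2.1
  have hϖ : Valued.v ϖ = WithZero.exp (-1 : ℤ) := hD.2.2.1
  -- (1) `c` is a non-norm; (2) the eigenvalues form a regular unit diagonal (★ p11 §1–§2)
  have hc : ¬ ∃ z : K, z * σ z = c := not_exists_mul_map_eq_of_dichotomy hD h2 hcv hdich
  have hs := v_vecCons_eq_one_of_isElementDatum hvσ hE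
  have hreg := vecCons_injective_of_isElementDatum hE
  have hϖ0 : ϖ ≠ 0 := (Valuation.ne_zero_iff _).1 (by rw [hϖ]; exact WithZero.exp_ne_zero)
  -- (5) `|8·X| = 8·|X| = 2·ampl`
  have h8 : ∀ (X : ℚ) (A : ℚ), |X| = A / 4 → |8 * X| = 2 * A := fun X A h => by
    rw [abs_mul, abs_of_pos (by norm_num : (0 : ℚ) < 8), h]; ring
  constructor
  · -- (3) type 0: κ-Stage A₀ (this seat's ★ (Oκ2c)₀, unconditional), then κ-Stage B₀
    rw [cast_sum_signChar_mul_ncard_eq_eight_mul_finsum_kappaCount_zero hσ hvσ hϖ (Units.mk0 ϖ hϖ0) rfl hσc hcv hc hdich hs hreg T hT i]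
    exact h8 _ _ (hBκ10 hD h2 hE T hT k hk i B hB)
  · -- (4) type 2: κ-Stage A₂ with multiplicity, then κ-Stage B₂
    rw [hAκ2 hσ hvσ hϖ (Units.mk0 ϖ hϖ0) rfl hσc hcv hc hdich hs hreg T hT i]
    exact h8 _ _ (hBκ10₂ hD h2 hE T hT k hk i B hB)

/-! ## ED. 2 (2026-09-04) — THE COMPLETE-FIELD κ-STAGE-B BINDERS (REF5 (g22) R5-96–R5-100 ∕ dealer LH4-plan (g11) WORD #43∕#45 ∕ heir LEAD (g19) T18-46 (2) ∕ LH-ref2 (g10) #26)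

ED. 1's `hBκ10`∕`hBκ10₂` quantify over EVERY valued field with finite residue field.  REF5's ℚ(i)-model — a NON-complete discretely valued field carrying a ramified quadratic
datum, in which `kappaCount ≡ 0` because norm classes from `K` itself are global — makes those two ∀-sentences FALSE, so ED. 1's head, though a theorem, has κ-Stage-B
hypotheses no seat can ever supply.  ED. 2 APPENDS the head of record `kappaModelSum_of_kappaStageB_complete`: the same sentence and the same proof, with `[CompleteSpace K]`
inserted between `[Valued K ℤᵐ⁰]` and `[Fintype 𝓀[K]]` in `hBκ10`∕`hBκ10₂` ONLY (`hAκ2` untouched — R5-99: it carries `c` and the dichotomy explicitly and is PAID by name by ★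
`F0P3cDyRamDiagonalKappaOrbitCountMult.kappaStageA_typeTwo_mult`).  The (KMS) conclusion is itself stated under `[CompleteSpace K]`, so the body re-elaborates unchanged
(REF5 probe `F0/P3a/F0P3a-ref5/g22/probe/Fk5.ED2probe.lean` a61b151b29555792).  Append-only: ED. 1's declaration above is byte-identical. -/

/-- **(KMS) MODULO COMPLETE-FIELD κ-STAGE B — ED. 2 HEAD OF RECORD: `stub_U3_kappaModelSum`'s SENTENCE TOKEN FOR TOKEN** (tree U3 ED. 8 :457–:479), from `hAκ2` (the κ-STAGE-A₂
head with multiplicity, exactly as in ED. 1) and the two κ-STAGE-B sums `hBκ10` (type 0: `|Σᶠ_{M ∈ 𝓛₀(T), IsDualisableLattice} kappaCount σ ϖ 0 i M · stabiliserWeight σ M| =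
ampl q k B ∕ 4`) and `hBκ10₂` (type 2, over `IsTypeTwoPolarisable`, `kappaCount σ ϖ 2`, `B + tauOfRecord d`), each now quantified over COMPLETE valued fields with finite residue
field (`[CompleteSpace K]` between `[Valued K ℤᵐ⁰]` and `[Fintype 𝓀[K]]`) — the generality in which the census law is meant and in which REF5's non-complete model does not live.
Proof = ED. 1's, line for line.
[cite: Kottwitz1986BaseChangeUnits, §1 pp. 240–241] [cite: Rogawski1990, §4.9 Prop. 4.9.1 (a) p. 55] [cite: LanglandsShelstad1987, §3] -/
theorem kappaModelSum_of_kappaStageB_complete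
    (hAκ2 : ∀ {K : Type} [Field K] [Valued K ℤᵐ⁰] [Finite 𝓀[K]] {σ : K →+* K}, (∀ x, σ (σ x) = x) → (∀ a, Valued.v (σ a) = Valued.v a) →
      ∀ {ϖ : K}, Valued.v ϖ = WithZero.exp (-1 : ℤ) → ∀ (ϖu : Kˣ), (ϖu : K) = ϖ →
      ∀ {c : K}, σ c = c → Valued.v c = 1 → (¬ ∃ z : K, z * σ z = c) →
        (∀ x : K, σ x = x → x ≠ 0 → (∃ z : K, z * σ z = x) ∨ ∃ z : K, z * σ z = c * x) →
      ∀ {s : Fin 3 → K}, (∀ i, Valued.v (s i) = 1) → (∀ i j, i ≠ j → s i ≠ s j) →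
      ∀ (T : GL (Fin 3) K), (T : Matrix (Fin 3) (Fin 3) K) = Matrix.diagonal s → ∀ (i : Fin 3),
        (((∑ e : Fin 3 → Bool,
            (![(if e 1 then -1 else 1) * (if e 2 then -1 else 1),
               (if e 0 then -1 else 1) * (if e 2 then -1 else 1),
               (if e 0 then -1 else 1) * (if e 1 then -1 else 1)] : Fin 3 → ℤ) i *
              ({M : Submodule 𝒪[K] (Fin 3 → K) |
                IsVertexLattice σ ϖ (Matrix.diagonal fun j => if e j then c else (1 : K)) 2 M ∧ mapGL T M = M}.ncard : ℤ) : ℤ) : ℚ)) =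
          8 * ∑ᶠ M₀ ∈ {M : Submodule 𝒪[K] (Fin 3 → K) | M ∈ normalisedStableLattices T ∧ IsTypeTwoPolarisable σ ϖ M},
            (kappaCount σ ϖ 2 i M₀ : ℚ) * stabiliserWeight σ M₀)
    (hBκ10 : ∀ {K : Type} [Field K] [Valued K ℤᵐ⁰] [CompleteSpace K] [Fintype 𝓀[K]] {σ : K →+* K} {ϖ : K} {d t : ℕ}, IsRamifiedQuadraticDatum σ ϖ d t →
      Valued.v (2 : K) < 1 → ∀ {α β : K} {n₁ n₂ n₃ : ℕ}, IsElementDatum σ ϖ (depthOfRecord d) α β n₁ n₂ n₃ →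
      ∀ (T : GL (Fin 3) K), (T : Matrix (Fin 3) (Fin 3) K) = Matrix.diagonal ![α, β, 1] → ∀ (k : ℕ), 2 * k + d = n₁ + n₂ + n₃ + 2 →
      ∀ (i : Fin 3) (B : ℤ), 2 * B = ((![n₁, n₂, n₃] : Fin 3 → ℕ) i : ℤ) - d + 2 - 2 * shiftR d t →
        |∑ᶠ M ∈ {M : Submodule 𝒪[K] (Fin 3 → K) | M ∈ normalisedStableLattices T ∧ IsDualisableLattice σ ϖ M},
            (kappaCount σ ϖ 0 i M : ℚ) * stabiliserWeight σ M| = ampl (Fintype.card 𝓀[K]) k B / 4)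
    (hBκ10₂ : ∀ {K : Type} [Field K] [Valued K ℤᵐ⁰] [CompleteSpace K] [Fintype 𝓀[K]] {σ : K →+* K} {ϖ : K} {d t : ℕ}, IsRamifiedQuadraticDatum σ ϖ d t →
      Valued.v (2 : K) < 1 → ∀ {α β : K} {n₁ n₂ n₃ : ℕ}, IsElementDatum σ ϖ (depthOfRecord d) α β n₁ n₂ n₃ →
      ∀ (T : GL (Fin 3) K), (T : Matrix (Fin 3) (Fin 3) K) = Matrix.diagonal ![α, β, 1] → ∀ (k : ℕ), 2 * k + d = n₁ + n₂ + n₃ + 2 →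
      ∀ (i : Fin 3) (B : ℤ), 2 * B = ((![n₁, n₂, n₃] : Fin 3 → ℕ) i : ℤ) - d + 2 - 2 * shiftR d t →
        |∑ᶠ M ∈ {M : Submodule 𝒪[K] (Fin 3 → K) | M ∈ normalisedStableLattices T ∧ IsTypeTwoPolarisable σ ϖ M},
            (kappaCount σ ϖ 2 i M : ℚ) * stabiliserWeight σ M| = ampl (Fintype.card 𝓀[K]) k (B + tauOfRecord d) / 4) :
    ∀ {K : Type} [Field K] [Valued K ℤᵐ⁰] [CompleteSpace K] [Fintype 𝓀[K]] (σ : K →+* K) (ϖ : K) (d t : ℕ),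
      DyadicFence (K := K) (IsRamifiedQuadraticDatum σ ϖ d t →
        ∀ c : K, σ c = c → Valued.v c = 1 → (∀ x : K, σ x = x → x ≠ 0 → (∃ z : K, z * σ z = x) ∨ ∃ z : K, z * σ z = c * x) →
        ∀ (α β : K) (n₁ n₂ n₃ : ℕ), IsElementDatum σ ϖ (depthOfRecord d) α β n₁ n₂ n₃ →
        ∀ (T : GL (Fin 3) K), (T : Matrix (Fin 3) (Fin 3) K) = Matrix.diagonal ![α, β, 1] →
        ∀ (k : ℕ), 2 * k + d = n₁ + n₂ + n₃ + 2 →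
        ∀ (i : Fin 3) (B : ℤ), 2 * B = ((![n₁, n₂, n₃] : Fin 3 → ℕ) i : ℤ) - d + 2 - 2 * shiftR d t →
          |((∑ s : Fin 3 → Bool,
              (![(if s 1 then -1 else 1) * (if s 2 then -1 else 1),
                 (if s 0 then -1 else 1) * (if s 2 then -1 else 1),
                 (if s 0 then -1 else 1) * (if s 1 then -1 else 1)] : Fin 3 → ℤ) i *
                ({M : Submodule 𝒪[K] (Fin 3 → K) |
                  IsVertexLattice σ ϖ (Matrix.diagonal fun j => if s j then c else (1 : K)) 0 M ∧ mapGL T M = M}.ncard : ℤ) : ℤ) : ℚ)| =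
            2 * ampl (Fintype.card 𝓀[K]) k B ∧
          |((∑ s : Fin 3 → Bool,
              (![(if s 1 then -1 else 1) * (if s 2 then -1 else 1),
                 (if s 0 then -1 else 1) * (if s 2 then -1 else 1),
                 (if s 0 then -1 else 1) * (if s 1 then -1 else 1)] : Fin 3 → ℤ) i *
                ({M : Submodule 𝒪[K] (Fin 3 → K) |
                  IsVertexLattice σ ϖ (Matrix.diagonal fun j => if s j then c else (1 : K)) 2 M ∧ mapGL T M = M}.ncard : ℤ) : ℤ) : ℚ)| =
            2 * ampl (Fintype.card 𝓀[K]) k (B + tauOfRecord d)) := by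
  intro K _ _ _ _ σ ϖ d t h2 hD c hσc hcv hdich α β n₁ n₂ n₃ hE T hT k hk i B hB
  have hσ : ∀ x, σ (σ x) = x := hD.1
  have hvσ : ∀ a, Valued.v (σ a) = Valued.v a := hD.2.1
  have hϖ : Valued.v ϖ = WithZero.exp (-1 : ℤ) := hD.2.2.1
  -- (1) `c` is a non-norm; (2) the eigenvalues form a regular unit diagonal (★ p11 §1–§2)
  have hc : ¬ ∃ z : K, z * σ z = c := not_exists_mul_map_eq_of_dichotomy hD h2 hcv hdich
  have hs := v_vecCons_eq_one_of_isElementDatum hvσ hE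
  have hreg := vecCons_injective_of_isElementDatum hE
  have hϖ0 : ϖ ≠ 0 := (Valuation.ne_zero_iff _).1 (by rw [hϖ]; exact WithZero.exp_ne_zero)
  -- (5) `|8·X| = 8·|X| = 2·ampl`
  have h8 : ∀ (X : ℚ) (A : ℚ), |X| = A / 4 → |8 * X| = 2 * A := fun X A h => by
    rw [abs_mul, abs_of_pos (by norm_num : (0 : ℚ) < 8), h]; ring
  constructor
  · -- (3) type 0: κ-Stage A₀ (this seat's ★ (Oκ2c)₀, unconditional), then κ-Stage B₀
    rw [cast_sum_signChar_mul_ncard_eq_eight_mul_finsum_kappaCount_zero hσ hvσ hϖ (Units.mk0 ϖ hϖ0) rfl hσc hcv hc hdich hs hreg T hT i]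
    exact h8 _ _ (hBκ10 hD h2 hE T hT k hk i B hB)
  · -- (4) type 2: κ-Stage A₂ with multiplicity, then κ-Stage B₂
    rw [hAκ2 hσ hvσ hϖ (Units.mk0 ϖ hϖ0) rfl hσc hcv hc hdich hs hreg T hT i]
    exact h8 _ _ (hBκ10₂ hD h2 hE T hT k hk i B hB)

end Summit.HodgeConjecture.HodgeConjecture.Cruxes.H413.F0P3cDyRamKappaModelSumOfKappaStageB

end
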